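import Mathlib

/-!
# P4FermatFactors — kernel-checked finite facts behind Lemma 8 / Remark 8.1 / «the hub factors» of
proofs/p4-k3-fermat-quotient-v1.3.md (pub-hodge-repro0): Shioda's admissible factors `A_S` of `J(X¹_m)`

For `α = (a, b, c) ∈ 𝔄¹_m` (`a + b + c ≡ 0 mod m`, all nonzero) Shioda 1981 (2.1)–(2.3) gives: `A_S` has dimension `φ(m′)/2`,
`m′ = m / gcd(a, b, c)`, CM by `ℤ[ζ_{m′}]`, and `H^{1,0}(A_S) = ⊕_{α′ ∈ S, |α′| = 1} U(α′)` where `|α| = Σ ⟨a_i/m⟩`;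
so the CM type of `A_S` is `Φ(α) = {t ∈ (ℤ/m)^× : |t·α| = 1}` (read modulo `m′`). Certified here by `decide`:
* `m = 12`, `(3,3,6)`: `m′ = 4`, `Φ = {1, 5}` (mod 12) — an elliptic curve with CM by `ℤ[i]` (`E_{ℚ(i)}`);
* `m = 12`, `(4,4,4)`: `m′ = 3`, `Φ = {1, 7}` — an elliptic curve with CM by `ℤ[ζ₃]` (`E_{ℚ(√−3)}`);
* `m = 8`, `(1,1,6)`: `m′ = 8`, `Φ = {1, 3}` = the stabiliser of `√−2 = ζ₈ + ζ₈³` in `(ℤ/8)^×` (a union of cosets of `{1,3}`,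
  not of `{1,5}` (stabiliser of `i`) nor of `{1,7}` (stabiliser of `√2`)): `A_S ∼ E_{ℚ(√−2)}²` — the hub factor of Corollary 6 for `ℚ(ζ₈)`;
* `m = 5`, `(1,1,3)`: `m′ = 5`, `Φ = {1, 2}` — the simple CM surface with CM by `ℤ[ζ₅]` (`S₅`);
* `m = 24`, `(1,2,21)`: `m′ = 24`, `Φ = {1, 5, 7, 13}` — p7's hub `D₂₄` (P7CnewHub.lean certifies the same set by another route).
Also the K-signature bookkeeping of Lemma 8 for `K = ℚ(ζ₁₂)`: with the embeddings `σ_t`, `t ∈ {1,5,7,11}`, `V₁ = K ⊗_{ℚ(i)} H¹(E_{ℚ(i)})`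
is of type `(1,0)` exactly at `t ∈ {1, 5}` (`σ_t(i) = i ⟺ t ≡ 1 mod 4`) and `V₂ = K ⊗_{ℚ(√−3)} H¹(E_{ℚ(√−3)})` exactly at
`t ∈ {1, 7}` (`σ_t(ζ₃) = ζ₃ ⟺ t ≡ 1 mod 3`); the real places of `K⁺ = ℚ(√3)` are `{1, 11}` (`v₊`) and `{5, 7}` (`v₋`)
(`σ_t(√3) = √3 ⟺ t ≡ ±1 mod 12`): signature `(2,0)` over `v₊`, `(1,1)` over `v₋`.
-/

namespace HodgeRepro0.P4FermatFactors

/-- the units of `ℤ/m` -/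
def units (m : Nat) : List Nat := (List.range m).filter (fun t => 1 ≤ t && Nat.gcd t m == 1)

/-- `m · |t·α| = Σ_i ((t a_i) mod m)` -/
def msum (m t : Nat) (α : List Nat) : Nat := (α.map (fun a => (t * a) % m)).sum

/-- the CM type `Φ(α) = {t ∈ (ℤ/m)^× : |t·α| = 1}` -/
def cmType (m : Nat) (α : List Nat) : List Nat := (units m).filter (fun t => msum m t α == m)

/-- `α ∈ 𝔄¹_m`: three nonzero residues with zero sum -/
def inA1 (m : Nat) (α : List Nat) : Bool := α.length == 3 && α.all (fun a => 0 < a && a < m) && α.sum % m == 0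

/-- the five orbits used, with `m`, `α`, `m′`, and the CM type claimed in the note -/
def claims : List (Nat × List Nat × Nat × List Nat) :=
  [(12, [3, 3, 6], 4, [1, 5]), (12, [4, 4, 4], 3, [1, 7]), (8, [1, 1, 6], 8, [1, 3]), (5, [1, 1, 3], 5, [1, 2]),
   (24, [1, 2, 21], 24, [1, 5, 7, 13])]

/-- one claim: `α ∈ 𝔄¹_m`, `m′ = m / gcd`, and `Φ(α)` is as claimed -/
def claimOk : Nat × List Nat × Nat × List Nat → Bool
  | (m, α, m', Φ) => inA1 m α && m / (α.foldl Nat.gcd m) == m' && cmType m α == Φ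

/-- every claim of `claims` holds (kernel-checked by `decide`). -/
theorem claims_ok : claims.all claimOk = true := by decide

/-- `Φ = {1,3} ⊂ (ℤ/8)^×` is a union of cosets of `H` iff `H ⊆ {1, 3}`-stable: true for `H = {1,3}`, false for `{1,5}` and `{1,7}`. -/
def cosetUnion (m : Nat) (H Φ : List Nat) : Bool := Φ.all (fun t => H.all (fun h => Φ.contains ((h * t) % m)))

/-- `{1,3}` is a union of cosets of `{1,3}` (stabiliser of `√−2`) but not of `{1,5}` (of `i`) nor `{1,7}` (of `√2`). -/
theorem phi13_cosets :
    cosetUnion 8 [1, 3] [1, 3] = true ∧ cosetUnion 8 [1, 5] [1, 3] = false ∧ cosetUnion 8 [1, 7] [1, 3] = false := by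
  decide

/-- Lemma 8 bookkeeping over `(ℤ/12)^× = {1,5,7,11}`: `t ≡ 1 (mod 4)` (type `(1,0)` for `V₁`) exactly for `t ∈ {1,5}`,
`t ≡ 1 (mod 3)` (type `(1,0)` for `V₂`) exactly for `t ∈ {1,7}`; over `v₊ = {1,11}` the count of `(1,0)`-types is `2 + 0`
and over `v₋ = {5,7}` it is `1 + 1`. -/
theorem lemma8_signature :
    (units 12).filter (fun t => t % 4 == 1) = [1, 5] ∧ (units 12).filter (fun t => t % 3 == 1) = [1, 7] ∧
    ([1, 11].filter (fun t => t % 4 == 1)).length + ([1, 11].filter (fun t => t % 3 == 1)).length = 2 ∧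
    ([5, 7].filter (fun t => t % 4 == 1)).length + ([5, 7].filter (fun t => t % 3 == 1)).length = 2 ∧
    ([1, 11].filter (fun t => t % 4 == 1)).length = 1 ∧ ([5, 7].filter (fun t => t % 4 == 1)).length = 1 := by
  decide

end HodgeRepro0.P4FermatFactors
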